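import Literature.Topology.FourManifolds.GluingGerms
import HarnessLib

/-!
# Smoothing the comparison map between two gluings (Hirsch's Theorem 8.1.9)

Seventh file of the proof of the tree's named fact
`Literature.Topology.FourManifolds.nonempty_diffeomorph_of_isBoundaryGluing` (`Gluing.lean`;
Hirsch (1976), Ch. 8, Thm. 2.1 / Thm. 1.9; Bröcker–Jänich (1982), (13.9) with (13.7)).

With the notation of `GluingGerms.lean` (gluing data `G`, `G'` of the same compact Hausdorff
pieces, comparison homeomorphism `F`, seam tubes `T`, `T'`, comparison frame `Fr`), the
uniqueness of collars (`CollarGerm.exists_extension`) applied to the two collar germs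
`Fr.germUp`, `Fr.germDown` of the comparison map yields compactly supported diffeomorphisms
`S₊`, `S₋` of the open half cylinders having the germs of `Γ̂ = T⁻¹ ∘ F⁻¹ ∘ T'` at the bottom.
Put `S = S₊ ∪ refl ∘ S₋ ∘ refl ∪ id` (a bijection of the cylinder, equal to `Γ̂` near the zero
level and to the identity outside `∂M × (-a₁, a₁)`) and `𝒯 = Ψ̂ ∘ S` (`Ψ̂ = T'⁻¹ ∘ F ∘ T`).
Then `𝒯` is the identity near the zero level, equals `Ψ̂` outside `∂M × (-a₁, a₁)`, and is
smooth; and **the map `𝒢 : P → P'`, `𝒢 = T' ∘ 𝒯 ∘ T⁻¹` near the seam and `𝒢 = F` away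
from it**, is a diffeomorphism (`ComparisonFrame.glueDiffeomorph`): this is the diffeomorphism
`f' ∪ f''` of Hirsch's proof of the smoothing theorem 8.1.9 (`f' = h` modified on a collar by
the uniqueness of collars), whence the uniqueness of gluings
`BoundaryGluingData.nonempty_diffeomorph`.

Everything here is proved; no named facts are introduced.

## References

* M. W. Hirsch, *Differential Topology*, GTM 33 (1976), Ch. 8 §1, Thm. 1.9 and its proof;
  §2, Thm. 2.1 (held copy, PDF pp. 168–171). [HirschDT1976]
* Th. Bröcker, K. Jänich, *Introduction to Differential Topology* (1982), (13.7), (13.9).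
  [BrockerJanich1982]
-/

open scoped Manifold ContDiff Topology
open Set Function Metric Filter Topology

noncomputable section

namespace Literature.Topology.FourManifolds

universe u v w

/-- Local notation: `𝔼 n` is the model Euclidean space `EuclideanSpace ℝ (Fin n)`. -/
local notation "𝔼 " n:arg => EuclideanSpace ℝ (Fin n)
/-- Local notation: `ℍ n` is the closed half space `EuclideanHalfSpace n`. -/
local notation "ℍ " n:arg => EuclideanHalfSpace n

namespace BoundaryGluingData

variable {n : ℕ} {M N : Type u} [TopologicalSpace M] [ChartedSpace (ℍ (n + 1)) M]
  [TopologicalSpace N] [ChartedSpace (ℍ (n + 1)) N]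
  {bM : BoundaryData (𝓡∂ (n + 1)) M (𝓡 n)} {bN : BoundaryData (𝓡∂ (n + 1)) N (𝓡 n)}
  {φ : bM.carrier ≃ bN.carrier}
  {P : Type v} [TopologicalSpace P] [ChartedSpace (𝔼 (n + 1)) P]
  {P' : Type w} [TopologicalSpace P'] [ChartedSpace (𝔼 (n + 1)) P']
  {G : BoundaryGluingData bM bN φ P} {G' : BoundaryGluingData bM bN φ P'}
  {T : G.SeamTube} {T' : G'.SeamTube}

namespace ComparisonFrame

/-! ### The extension data -/

/-- **The output of the uniqueness of collars for the two germs of the comparison map**: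
diffeomorphisms `Sp`, `Sm` (with inverses `Spi`, `Smi`) of the open upper half cylinder
`∂M × (0, ∞)`, with `Sp = Γ̂` on `∂M × (0, ap₂]`, `Sm = refl ∘ Γ̂ ∘ refl` on `∂M × (0, am₂]`, and
both the identity above levels `ap₁, am₁ < δ` (`CollarGerm.exists_extension` for `Fr.germUp`,
`Fr.germDown`).  Existence: `nonempty_ext`. [folklore] -/
structure Ext (Fr : ComparisonFrame T T') where
  /-- The upper extension. -/
  Sp : bM.carrier × ℝ → bM.carrier × ℝ
  /-- Its inverse. -/
  Spi : bM.carrier × ℝ → bM.carrier × ℝ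
  /-- The lower extension (in reflected coordinates). -/
  Sm : bM.carrier × ℝ → bM.carrier × ℝ
  /-- Its inverse. -/
  Smi : bM.carrier × ℝ → bM.carrier × ℝ
  /-- Levels. -/
  ap₁ : ℝ
  ap₂ : ℝ
  am₁ : ℝ
  am₂ : ℝ
  ap₂_pos : 0 < ap₂
  ap₂_lt : ap₂ < ap₁
  ap₁_lt : ap₁ < Fr.δ
  am₂_pos : 0 < am₂
  am₂_lt : am₂ < am₁
  am₁_lt : am₁ < Fr.δ
  smooth_Sp : ContMDiffOn ((𝓡 n).prod 𝓘(ℝ, ℝ)) ((𝓡 n).prod 𝓘(ℝ, ℝ)) ∞ Sp (univ ×ˢ Ioi 0)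
  smooth_Spi : ContMDiffOn ((𝓡 n).prod 𝓘(ℝ, ℝ)) ((𝓡 n).prod 𝓘(ℝ, ℝ)) ∞ Spi (univ ×ˢ Ioi 0)
  smooth_Sm : ContMDiffOn ((𝓡 n).prod 𝓘(ℝ, ℝ)) ((𝓡 n).prod 𝓘(ℝ, ℝ)) ∞ Sm (univ ×ˢ Ioi 0)
  smooth_Smi : ContMDiffOn ((𝓡 n).prod 𝓘(ℝ, ℝ)) ((𝓡 n).prod 𝓘(ℝ, ℝ)) ∞ Smi (univ ×ˢ Ioi 0)
  maps_Sp : MapsTo Sp (univ ×ˢ Ioi (0 : ℝ)) (univ ×ˢ Ioi (0 : ℝ))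
  maps_Spi : MapsTo Spi (univ ×ˢ Ioi (0 : ℝ)) (univ ×ˢ Ioi (0 : ℝ))
  maps_Sm : MapsTo Sm (univ ×ˢ Ioi (0 : ℝ)) (univ ×ˢ Ioi (0 : ℝ))
  maps_Smi : MapsTo Smi (univ ×ˢ Ioi (0 : ℝ)) (univ ×ˢ Ioi (0 : ℝ))
  Spi_Sp : ∀ q ∈ (univ : Set bM.carrier) ×ˢ Ioi (0 : ℝ), Spi (Sp q) = q
  Sp_Spi : ∀ q ∈ (univ : Set bM.carrier) ×ˢ Ioi (0 : ℝ), Sp (Spi q) = q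
  Smi_Sm : ∀ q ∈ (univ : Set bM.carrier) ×ˢ Ioi (0 : ℝ), Smi (Sm q) = q
  Sm_Smi : ∀ q ∈ (univ : Set bM.carrier) ×ˢ Ioi (0 : ℝ), Sm (Smi q) = q
  Sp_eq : ∀ q ∈ (univ : Set bM.carrier) ×ˢ Ioc 0 ap₂, Sp q = gamHat T T' q
  Sp_id : ∀ q ∈ (univ : Set bM.carrier) ×ˢ Ici ap₁, Sp q = q
  Sm_eq : ∀ q ∈ (univ : Set bM.carrier) ×ˢ Ioc 0 am₂, Sm q = reflT (gamHat T T' (reflT q))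
  Sm_id : ∀ q ∈ (univ : Set bM.carrier) ×ˢ Ici am₁, Sm q = q

section Construction

variable [T2Space M] [T2Space N] [CompactSpace M] [CompactSpace N]
  [IsManifold (𝓡∂ (n + 1)) ∞ M] [IsManifold (𝓡∂ (n + 1)) ∞ N] [IsManifold (𝓡 (n + 1)) ∞ P]
  [IsManifold (𝓡 (n + 1)) ∞ P'] (Fr : ComparisonFrame T T')

/-- **The extension data exist** (uniqueness of collars, twice). [folklore] -/
theorem nonempty_ext [Nonempty bM.carrier] : Nonempty Fr.Ext := by
  haveI : Nonempty M := ⟨bM.incl (Classical.arbitrary _)⟩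
  haveI : Nonempty N := ⟨bN.incl (φ (Classical.arbitrary _))⟩
  haveI : CompactSpace bM.carrier := bM.compactSpace_carrier
  obtain ⟨Sp, Spi, ap₁, ap₂, hp₂, hp₂₁, hp₁, hs1, hs2, hm1, hm2, hi1, hi2, heq1, hid1⟩ :=
    Fr.germUp.exists_extension
  obtain ⟨Sm, Smi, am₁, am₂, hq₂, hq₂₁, hq₁, hs3, hs4, hm3, hm4, hi3, hi4, heq2, hid2⟩ :=
    Fr.germDown.exists_extension
  exact ⟨{ Sp := Sp, Spi := Spi, Sm := Sm, Smi := Smi, ap₁ := ap₁, ap₂ := ap₂, am₁ := am₁, am₂ := am₂,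
           ap₂_pos := hp₂, ap₂_lt := hp₂₁, ap₁_lt := hp₁, am₂_pos := hq₂, am₂_lt := hq₂₁, am₁_lt := hq₁,
           smooth_Sp := hs1, smooth_Spi := hs2, smooth_Sm := hs3, smooth_Smi := hs4,
           maps_Sp := hm1, maps_Spi := hm2, maps_Sm := hm3, maps_Smi := hm4,
           Spi_Sp := hi1, Sp_Spi := hi2, Smi_Sm := hi3, Sm_Smi := hi4,
           Sp_eq := fun q hq => (heq1 q hq).1, Sp_id := hid1,
           Sm_eq := fun q hq => (heq2 q hq).1, Sm_id := hid2 }⟩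

end Construction

namespace Ext

variable {Fr : ComparisonFrame T T'} (E : Fr.Ext)

/-- The common modification level `a₁ = max ap₁ am₁ < δ`. [folklore] -/
def a₁ : ℝ := max E.ap₁ E.am₁

/-- The common germ level `a₂ = min ap₂ am₂ > 0`. [folklore] -/
def a₂ : ℝ := min E.ap₂ E.am₂

/-- `a₁ < δ`. [folklore] -/
theorem a₁_lt : E.a₁ < Fr.δ := max_lt E.ap₁_lt E.am₁_lt

/-- `0 < a₂`. [folklore] -/
theorem a₂_pos : 0 < E.a₂ := lt_min E.ap₂_pos E.am₂_pos

/-- `a₂ < a₁`. [folklore] -/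
theorem a₂_lt_a₁ : E.a₂ < E.a₁ := (min_le_left _ _).trans_lt (E.ap₂_lt.trans_le (le_max_left _ _))

/-- `0 < a₁`. [folklore] -/
theorem a₁_pos : 0 < E.a₁ := E.a₂_pos.trans E.a₂_lt_a₁

/-! ### The glued reparametrisation `S` of the cylinder and its inverse -/

/-- **The glued reparametrisation** `S = S₊` above the zero level, `refl ∘ S₋ ∘ refl` below, the
identity on the zero level. [folklore] -/
def sfull (q : bM.carrier × ℝ) : bM.carrier × ℝ :=
  if 0 < q.2 then E.Sp q else if q.2 < 0 then reflT (E.Sm (reflT q)) else q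

/-- **Its inverse.** [folklore] -/
def sfullInv (q : bM.carrier × ℝ) : bM.carrier × ℝ :=
  if 0 < q.2 then E.Spi q else if q.2 < 0 then reflT (E.Smi (reflT q)) else q

/-- `S = S₊` above the zero level. [folklore] -/
theorem sfull_of_pos {q : bM.carrier × ℝ} (hq : 0 < q.2) : E.sfull q = E.Sp q := by
  simp [sfull, hq]

/-- `S = refl ∘ S₋ ∘ refl` below the zero level. [folklore] -/
theorem sfull_of_neg {q : bM.carrier × ℝ} (hq : q.2 < 0) : E.sfull q = reflT (E.Sm (reflT q)) := by
  simp [sfull, hq, not_lt.2 hq.le]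

/-- `S = id` on the zero level. [folklore] -/
theorem sfull_of_zero {q : bM.carrier × ℝ} (hq : q.2 = 0) : E.sfull q = q := by
  simp [sfull, hq]

/-- `S⁻¹ = S₊⁻¹` above the zero level. [folklore] -/
theorem sfullInv_of_pos {q : bM.carrier × ℝ} (hq : 0 < q.2) : E.sfullInv q = E.Spi q := by
  simp [sfullInv, hq]

/-- `S⁻¹ = refl ∘ S₋⁻¹ ∘ refl` below the zero level. [folklore] -/
theorem sfullInv_of_neg {q : bM.carrier × ℝ} (hq : q.2 < 0) :
    E.sfullInv q = reflT (E.Smi (reflT q)) := by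
  simp [sfullInv, hq, not_lt.2 hq.le]

/-- `S⁻¹ = id` on the zero level. [folklore] -/
theorem sfullInv_of_zero {q : bM.carrier × ℝ} (hq : q.2 = 0) : E.sfullInv q = q := by
  simp [sfullInv, hq]

/-- `S` preserves the sign of the height: positive. [folklore] -/
theorem sfull_snd_pos {q : bM.carrier × ℝ} (hq : 0 < q.2) : 0 < (E.sfull q).2 := by
  rw [E.sfull_of_pos hq]; exact (E.maps_Sp ⟨mem_univ _, hq⟩).2

/-- `S` preserves the sign of the height: negative. [folklore] -/
theorem sfull_snd_neg {q : bM.carrier × ℝ} (hq : q.2 < 0) : (E.sfull q).2 < 0 := by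
  rw [E.sfull_of_neg hq]
  have := (E.maps_Sm ⟨mem_univ _, show 0 < (reflT q).2 by simp [reflT]; linarith⟩).2
  simp only [reflT, mem_Ioi] at this ⊢
  linarith

/-- `S⁻¹` preserves the sign of the height: positive. [folklore] -/
theorem sfullInv_snd_pos {q : bM.carrier × ℝ} (hq : 0 < q.2) : 0 < (E.sfullInv q).2 := by
  rw [E.sfullInv_of_pos hq]; exact (E.maps_Spi ⟨mem_univ _, hq⟩).2

/-- `S⁻¹` preserves the sign of the height: negative. [folklore] -/
theorem sfullInv_snd_neg {q : bM.carrier × ℝ} (hq : q.2 < 0) : (E.sfullInv q).2 < 0 := by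
  rw [E.sfullInv_of_neg hq]
  have := (E.maps_Smi ⟨mem_univ _, show 0 < (reflT q).2 by simp [reflT]; linarith⟩).2
  simp only [reflT, mem_Ioi] at this ⊢
  linarith

/-- `S⁻¹ ∘ S = id`. [folklore] -/
theorem sfullInv_sfull (q : bM.carrier × ℝ) : E.sfullInv (E.sfull q) = q := by
  rcases lt_trichotomy 0 q.2 with hq | hq | hq
  · rw [E.sfullInv_of_pos (E.sfull_snd_pos hq), E.sfull_of_pos hq, E.Spi_Sp q ⟨mem_univ _, hq⟩]
  · rw [E.sfull_of_zero hq.symm, E.sfullInv_of_zero hq.symm]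
  · rw [E.sfullInv_of_neg (E.sfull_snd_neg hq), E.sfull_of_neg hq, reflT_reflT,
      E.Smi_Sm _ ⟨mem_univ _, show 0 < (reflT q).2 by simp [reflT]; linarith⟩, reflT_reflT]

/-- `S ∘ S⁻¹ = id`. [folklore] -/
theorem sfull_sfullInv (q : bM.carrier × ℝ) : E.sfull (E.sfullInv q) = q := by
  rcases lt_trichotomy 0 q.2 with hq | hq | hq
  · rw [E.sfull_of_pos (E.sfullInv_snd_pos hq), E.sfullInv_of_pos hq, E.Sp_Spi q ⟨mem_univ _, hq⟩]
  · rw [E.sfullInv_of_zero hq.symm, E.sfull_of_zero hq.symm]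
  · rw [E.sfull_of_neg (E.sfullInv_snd_neg hq), E.sfullInv_of_neg hq, reflT_reflT,
      E.Sm_Smi _ ⟨mem_univ _, show 0 < (reflT q).2 by simp [reflT]; linarith⟩, reflT_reflT]

/-- **Near the zero level `S = Γ̂`.** [folklore] -/
theorem sfull_eq_gamHat {q : bM.carrier × ℝ} (hq : q.2 ∈ Icc (-E.a₂) E.a₂) : E.sfull q = gamHat T T' q := by
  rcases lt_trichotomy 0 q.2 with h | h | h
  · have ha : E.a₂ ≤ E.ap₂ := min_le_left _ _
    rw [E.sfull_of_pos h]
    exact E.Sp_eq q ⟨mem_univ _, h, hq.2.trans ha⟩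
  · obtain ⟨x, t⟩ := q
    simp only at h; subst h
    rw [E.sfull_of_zero rfl, gamHat_zero]
  · have ha : E.a₂ ≤ E.am₂ := min_le_right _ _
    rw [E.sfull_of_neg h, E.Sm_eq (reflT q) ⟨mem_univ _, ?_⟩, reflT_reflT, reflT_reflT]
    simp only [reflT]
    exact ⟨by linarith, by linarith [hq.1]⟩

/-- **Outside `∂M × (-a₁, a₁)`, `S = id`.** [folklore] -/
theorem sfull_eq_self {q : bM.carrier × ℝ} (hq : E.a₁ ≤ |q.2|) : E.sfull q = q := by
  rcases lt_trichotomy 0 q.2 with h | h | h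
  · rw [E.sfull_of_pos h]
    exact E.Sp_id q ⟨mem_univ _, (le_max_left _ _).trans (by rwa [abs_of_pos h] at hq)⟩
  · exact E.sfull_of_zero h.symm
  · rw [E.sfull_of_neg h, E.Sm_id (reflT q) ⟨mem_univ _, ?_⟩, reflT_reflT]
    show E.am₁ ≤ -q.2
    rw [abs_of_neg h] at hq
    exact (le_max_right _ _).trans hq

/-- **Outside `∂M × (-a₁, a₁)`, `S⁻¹ = id`.** [folklore] -/
theorem sfullInv_eq_self {q : bM.carrier × ℝ} (hq : E.a₁ ≤ |q.2|) : E.sfullInv q = q := by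
  have := E.sfullInv_sfull q
  rwa [E.sfull_eq_self hq] at this

/-- **`S` preserves the slab `∂M × (-c, c)` for `c ≥ a₁`** (it is a bijection equal to the
identity off `∂M × (-a₁, a₁)`). [folklore] -/
theorem abs_sfull_snd_lt {q : bM.carrier × ℝ} {c : ℝ} (hc : E.a₁ ≤ c) (hq : |q.2| < c) :
    |(E.sfull q).2| < c := by
  by_contra h
  rw [not_lt] at h
  have h1 : E.sfullInv (E.sfull q) = E.sfull q := E.sfullInv_eq_self (hc.trans h)
  rw [E.sfullInv_sfull] at h1
  rw [h1] at hq
  exact absurd hq (not_lt.2 h)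

/-- `S⁻¹` preserves the slab `∂M × (-c, c)` for `c ≥ a₁`. [folklore] -/
theorem abs_sfullInv_snd_lt {q : bM.carrier × ℝ} {c : ℝ} (hc : E.a₁ ≤ c) (hq : |q.2| < c) :
    |(E.sfullInv q).2| < c := by
  by_contra h
  rw [not_lt] at h
  have h1 : E.sfull (E.sfullInv q) = E.sfullInv q := E.sfull_eq_self (hc.trans h)
  rw [E.sfull_sfullInv] at h1
  rw [h1] at hq
  exact absurd hq (not_lt.2 h)

/-! ### The corrected germ `𝒯 = Ψ̂ ∘ S` and its inverse `S⁻¹ ∘ Γ̂` -/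

/-- **The corrected germ** `𝒯 = Ψ̂ ∘ S`. [folklore] -/
def tmap (q : bM.carrier × ℝ) : bM.carrier × ℝ := psiHat T T' (E.sfull q)

/-- **Its inverse** `S⁻¹ ∘ Γ̂`. [folklore] -/
def tinv (q : bM.carrier × ℝ) : bM.carrier × ℝ := E.sfullInv (gamHat T T' q)

/-- **Near the zero level `𝒯 = id`**: on `∂M × (-a₂, a₂)`. [folklore] -/
theorem tmap_eq_self {q : bM.carrier × ℝ} (hq : |q.2| < E.a₂) : E.tmap q = q := by
  rw [tmap, E.sfull_eq_gamHat (abs_le.1 hq.le)]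
  refine Fr.psiHat_gamHat ⟨?_, ?_⟩
  · have := (abs_lt.1 hq).1; linarith [E.a₂_lt_a₁, E.a₁_lt, Fr.δ_le_b]
  · have := (abs_lt.1 hq).2; linarith [E.a₂_lt_a₁, E.a₁_lt, Fr.δ_le_b]

/-- **Outside `∂M × (-a₁, a₁)`, `𝒯 = Ψ̂`.** [folklore] -/
theorem tmap_eq_psiHat {q : bM.carrier × ℝ} (hq : E.a₁ ≤ |q.2|) : E.tmap q = psiHat T T' q := by
  rw [tmap, E.sfull_eq_self hq]

/-- **Outside `∂M × (-a₁, a₁)` (measured after `Γ̂`), `𝒯⁻¹ = Γ̂`.** [folklore] -/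
theorem tinv_eq_gamHat {q : bM.carrier × ℝ} (hq : E.a₁ ≤ |(gamHat T T' q).2|) :
    E.tinv q = gamHat T T' q := by
  rw [tinv, E.sfullInv_eq_self hq]

/-- `𝒯` carries `∂M × (-δ, δ)` into itself. [folklore] -/
theorem abs_sfull_snd_lt_δ {q : bM.carrier × ℝ} (hq : |q.2| < Fr.δ) : |(E.sfull q).2| < Fr.δ :=
  E.abs_sfull_snd_lt E.a₁_lt.le hq

section Smooth

variable [T2Space M] [T2Space N] [CompactSpace M] [CompactSpace N]
  [IsManifold (𝓡∂ (n + 1)) ∞ M] [IsManifold (𝓡∂ (n + 1)) ∞ N] [IsManifold (𝓡 (n + 1)) ∞ P]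
  [IsManifold (𝓡 (n + 1)) ∞ P']

omit [T2Space M] [T2Space N] [CompactSpace M] [CompactSpace N] [IsManifold (𝓡∂ (n + 1)) ∞ M]
  [IsManifold (𝓡∂ (n + 1)) ∞ N] [IsManifold (𝓡 (n + 1)) ∞ P] [IsManifold (𝓡 (n + 1)) ∞ P'] in
/-- The image of the interior of `M` is `range jA` minus the seam. [folklore] -/
theorem _root_.Literature.Topology.FourManifolds.BoundaryGluingData.mem_image_interior_iff
    (G : BoundaryGluingData bM bN φ P) (p : P) :
    p ∈ G.jA '' (𝓡∂ (n + 1)).interior M ↔ p ∈ range G.jA ∧ p ∉ G.seam := by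
  constructor
  · rintro ⟨a, ha, rfl⟩
    refine ⟨mem_range_self a, fun hs => ?_⟩
    rw [G.jA_mem_seam_iff, bM.range_incl, ← ModelWithCorners.compl_interior] at hs
    exact hs ha
  · rintro ⟨⟨a, rfl⟩, hs⟩
    refine ⟨a, ?_, rfl⟩
    by_contra ha
    apply hs
    rw [G.jA_mem_seam_iff, bM.range_incl, ← ModelWithCorners.compl_interior]
    exact ha

omit [T2Space M] [T2Space N] [CompactSpace M] [CompactSpace N] [IsManifold (𝓡∂ (n + 1)) ∞ M]
  [IsManifold (𝓡∂ (n + 1)) ∞ N] [IsManifold (𝓡 (n + 1)) ∞ P] [IsManifold (𝓡 (n + 1)) ∞ P'] in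
/-- The comparison map preserves the image of the interior of `M`. [folklore] -/
theorem _root_.Literature.Topology.FourManifolds.BoundaryGluingData.compare_mem_image_interior_iff
    (G : BoundaryGluingData bM bN φ P) (G' : BoundaryGluingData bM bN φ P') (p : P) :
    G.compare G' p ∈ G'.jA '' (𝓡∂ (n + 1)).interior M ↔ p ∈ G.jA '' (𝓡∂ (n + 1)).interior M := by
  rw [G'.mem_image_interior_iff, G.mem_image_interior_iff, G.compare_mem_range_jA_iff G',
    G.compare_mem_seam_iff G']

omit [T2Space M] [T2Space N] [CompactSpace M] [CompactSpace N] [IsManifold (𝓡∂ (n + 1)) ∞ M]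
  [IsManifold (𝓡∂ (n + 1)) ∞ N] [IsManifold (𝓡 (n + 1)) ∞ P] [IsManifold (𝓡 (n + 1)) ∞ P'] in
/-- The comparison map preserves the image of the interior of `N`. [folklore] -/
theorem _root_.Literature.Topology.FourManifolds.BoundaryGluingData.compare_mem_image_interior_iff'
    (G : BoundaryGluingData bM bN φ P) (G' : BoundaryGluingData bM bN φ P') (p : P) :
    G.compare G' p ∈ G'.jB '' (𝓡∂ (n + 1)).interior N ↔ p ∈ G.jB '' (𝓡∂ (n + 1)).interior N := by
  have := G.symm.compare_mem_image_interior_iff G'.symm p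
  simp only [symm_compare_symm, symm_jA] at this
  exact this

omit [T2Space M] [T2Space N] [CompactSpace M] [CompactSpace N] [IsManifold (𝓡∂ (n + 1)) ∞ M]
  [IsManifold (𝓡∂ (n + 1)) ∞ N] [IsManifold (𝓡 (n + 1)) ∞ P] [IsManifold (𝓡 (n + 1)) ∞ P'] in
/-- The height of `Γ̂` is positive on `∂M × (0, b)`. [folklore] -/
theorem gamHat_snd_pos {q : bM.carrier × ℝ} (hq : q.2 ∈ Ioo 0 Fr.b) : 0 < (gamHat T T' q).2 := by
  rw [gamHat_snd, T.height_pos_iff, G'.compare_mem_image_interior_iff G, show q = (q.1, q.2) from rfl]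
  exact T'.toFun_mem_image_interior q.1 ⟨hq.1, hq.2.trans_le Fr.b_le⟩

omit [T2Space M] [T2Space N] [CompactSpace M] [CompactSpace N] [IsManifold (𝓡∂ (n + 1)) ∞ M]
  [IsManifold (𝓡∂ (n + 1)) ∞ N] [IsManifold (𝓡 (n + 1)) ∞ P] [IsManifold (𝓡 (n + 1)) ∞ P'] in
/-- The height of `Γ̂` is negative on `∂M × (-b, 0)`. [folklore] -/
theorem gamHat_snd_neg' {q : bM.carrier × ℝ} (hq : q.2 ∈ Ioo (-Fr.b) 0) : (gamHat T T' q).2 < 0 := by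
  rw [gamHat_snd, T.height_neg_iff, G'.compare_mem_image_interior_iff' G,
    show q = (q.1, q.2) from rfl]
  exact T'.toFun_mem_image_interior' q.1 ⟨by linarith [hq.1, Fr.b_le], hq.2⟩

omit [T2Space M] [T2Space N] [CompactSpace M] [CompactSpace N] [IsManifold (𝓡 (n + 1)) ∞ P'] in
/-- **`𝒯` is `C^∞` on `∂M × (-δ, δ)`**: above the zero level it is `Ψ̂ ∘ S₊`, below it is
`Ψ̂ ∘ refl ∘ S₋ ∘ refl` (smooth composites, the inner maps staying in the one-sided slabs on
which `Ψ̂` is smooth), and near the zero level it is the identity. [folklore] -/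
theorem contMDiffOn_tmap [Nonempty bM.carrier] :
    ContMDiffOn ((𝓡 n).prod 𝓘(ℝ, ℝ)) ((𝓡 n).prod 𝓘(ℝ, ℝ)) ∞ E.tmap (univ ×ˢ Ioo (-Fr.δ) Fr.δ) := by
  haveI : Nonempty M := ⟨bM.incl (Classical.arbitrary _)⟩
  haveI : Nonempty N := ⟨bN.incl (φ (Classical.arbitrary _))⟩
  rintro q ⟨-, hq⟩
  refine ContMDiffAt.contMDiffWithinAt ?_
  rcases lt_trichotomy 0 q.2 with h | h | h
  · -- above: `Ψ̂ ∘ S₊` on `∂M × (0, δ)`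
    have hO : IsOpen ((univ : Set bM.carrier) ×ˢ Ioo 0 Fr.δ) := isOpen_univ.prod isOpen_Ioo
    have hqO : q ∈ (univ : Set bM.carrier) ×ˢ Ioo 0 Fr.δ := ⟨mem_univ _, h, hq.2⟩
    have hmaps : MapsTo E.Sp ((univ : Set bM.carrier) ×ˢ Ioo 0 Fr.δ) (univ ×ˢ Ico 0 Fr.δ) := by
      intro q' hq'
      refine ⟨mem_univ _, le_of_lt (E.maps_Sp ⟨mem_univ _, hq'.2.1⟩).2, ?_⟩
      have h1 := E.abs_sfull_snd_lt_δ (q := q') (by rw [abs_of_pos hq'.2.1]; exact hq'.2.2)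
      rw [E.sfull_of_pos hq'.2.1] at h1
      exact (abs_lt.1 h1).2
    have hcomp : ContMDiffWithinAt ((𝓡 n).prod 𝓘(ℝ, ℝ)) ((𝓡 n).prod 𝓘(ℝ, ℝ)) ∞ (psiHat T T' ∘ E.Sp)
        (univ ×ˢ Ioo 0 Fr.δ) q :=
      (Fr.contMDiffOn_psiHat_up _ (hmaps hqO)).comp q
        ((E.smooth_Sp q ⟨mem_univ _, h⟩).mono (prod_mono Subset.rfl Ioo_subset_Ioi_self)) hmaps
    refine (hcomp.contMDiffAt (hO.mem_nhds hqO)).congr_of_eventuallyEq ?_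
    filter_upwards [(isOpen_lt continuous_const continuous_snd).mem_nhds h] with q' hq'
    exact congrArg (psiHat T T') (E.sfull_of_pos hq')
  · -- near the zero level: the identity
    have hq0 : |q.2| < E.a₂ := by rw [← h, abs_zero]; exact E.a₂_pos
    refine contMDiffAt_id.congr_of_eventuallyEq ?_
    filter_upwards [(isOpen_lt (continuous_abs.comp continuous_snd) continuous_const).mem_nhds hq0]
      with q' hq'
    exact E.tmap_eq_self hq'
  · -- below: `Ψ̂ ∘ refl ∘ S₋ ∘ refl` on `∂M × (-δ, 0)`
    have hO : IsOpen ((univ : Set bM.carrier) ×ˢ Ioo (-Fr.δ) 0) := isOpen_univ.prod isOpen_Ioo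
    have hqO : q ∈ (univ : Set bM.carrier) ×ˢ Ioo (-Fr.δ) 0 := ⟨mem_univ _, hq.1, h⟩
    set inner : bM.carrier × ℝ → bM.carrier × ℝ := fun q' => reflT (E.Sm (reflT q')) with hinner
    have hmaps : MapsTo inner ((univ : Set bM.carrier) ×ˢ Ioo (-Fr.δ) 0) (univ ×ˢ Ioc (-Fr.δ) 0) := by
      intro q' hq'
      have h1 := E.abs_sfull_snd_lt_δ (q := q') (by rw [abs_of_neg hq'.2.2]; linarith [hq'.2.1])
      have h2 := E.sfull_snd_neg (q := q') hq'.2.2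
      rw [E.sfull_of_neg hq'.2.2] at h1 h2
      exact ⟨mem_univ _, (abs_lt.1 h1).1, h2.le⟩
    have hmapsR : MapsTo (reflT (bM := bM)) ((univ : Set bM.carrier) ×ˢ Ioo (-Fr.δ) 0) (univ ×ˢ Ioi 0) :=
      fun q' hq' => ⟨mem_univ _, by show 0 < -q'.2; linarith [hq'.2.2]⟩
    have hin : ContMDiffWithinAt ((𝓡 n).prod 𝓘(ℝ, ℝ)) ((𝓡 n).prod 𝓘(ℝ, ℝ)) ∞ inner
        (univ ×ˢ Ioo (-Fr.δ) 0) q :=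
      contMDiff_reflT.contMDiffAt.comp_contMDiffWithinAt q
        ((E.smooth_Sm _ (hmapsR hqO)).comp q (contMDiff_reflT _).contMDiffWithinAt hmapsR)
    have hcomp : ContMDiffWithinAt ((𝓡 n).prod 𝓘(ℝ, ℝ)) ((𝓡 n).prod 𝓘(ℝ, ℝ)) ∞ (psiHat T T' ∘ inner)
        (univ ×ˢ Ioo (-Fr.δ) 0) q :=
      (Fr.contMDiffOn_psiHat_down _ (hmaps hqO)).comp q hin hmaps
    refine (hcomp.contMDiffAt (hO.mem_nhds hqO)).congr_of_eventuallyEq ?_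
    filter_upwards [(isOpen_lt continuous_snd continuous_const).mem_nhds h] with q' hq'
    exact congrArg (psiHat T T') (E.sfull_of_neg hq')

omit [T2Space M] [T2Space N] [CompactSpace N] in
/-- **`𝒯⁻¹` is `C^∞` on `∂M × (-b, b)`** (symmetrically: `S₊⁻¹ ∘ Γ̂`, `refl ∘ S₋⁻¹ ∘ refl ∘ Γ̂`,
and the identity near the zero level). [folklore] -/
theorem contMDiffOn_tinv [Nonempty bM.carrier] :
    ContMDiffOn ((𝓡 n).prod 𝓘(ℝ, ℝ)) ((𝓡 n).prod 𝓘(ℝ, ℝ)) ∞ E.tinv (univ ×ˢ Ioo (-Fr.b) Fr.b) := by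
  haveI : Nonempty M := ⟨bM.incl (Classical.arbitrary _)⟩
  haveI : Nonempty N := ⟨bN.incl (φ (Classical.arbitrary _))⟩
  haveI : CompactSpace bM.carrier := bM.compactSpace_carrier
  -- the identity near the zero level: two tube-lemma constants
  obtain ⟨c₁, hc₁, hsub₁⟩ := exists_prod_Ioo_subset_of_isOpen
    (isOpen_Ioo.preimage (T'.contMDiff_height.continuous.comp
      ((G.continuous_compare G').comp T.contMDiff_toFun.continuous)) :
      IsOpen ((fun q : bM.carrier × ℝ => T'.height (G.compare G' (T.toFun q))) ⁻¹' Ioo (-E.a₂) E.a₂))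
    (fun x => by
      show T'.height (G.compare G' (T.toFun (x, 0))) ∈ Ioo (-E.a₂) E.a₂
      rw [T.toFun_zero, compare_jA, (T'.height_eq_zero_iff _).2 (G'.jA_incl_mem_seam x)]
      exact ⟨by linarith [E.a₂_pos], E.a₂_pos⟩)
  have hid₁ : ∀ q : bM.carrier × ℝ, |q.2| < min c₁ Fr.δ → E.sfullInv q = psiHat T T' q := by
    intro q hq
    have hq₁ : |q.2| < c₁ := hq.trans_le (min_le_left _ _)
    have hqδ : |q.2| < Fr.δ := hq.trans_le (min_le_right _ _)
    have hr : |(psiHat T T' q).2| < E.a₂ := by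
      rw [psiHat_snd]
      have := hsub₁ ⟨mem_univ q.1, (abs_lt.1 hq₁ : -c₁ < q.2 ∧ q.2 < c₁)⟩
      exact abs_lt.2 this
    have h1 : E.sfull (psiHat T T' q) = q := by
      rw [E.sfull_eq_gamHat (abs_le.1 hr.le)]
      exact Fr.gamHat_psiHat (abs_lt.1 hqδ)
    have := E.sfullInv_sfull (psiHat T T' q)
    rwa [h1] at this
  obtain ⟨c₂, hc₂, hsub₂⟩ := exists_prod_Ioo_subset_of_isOpen
    (isOpen_Ioo.preimage (T.contMDiff_height.continuous.comp
      ((G'.continuous_compare G).comp T'.contMDiff_toFun.continuous)) :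
      IsOpen ((fun q : bM.carrier × ℝ => T.height (G'.compare G (T'.toFun q))) ⁻¹'
        Ioo (-min c₁ Fr.δ) (min c₁ Fr.δ)))
    (fun x => by
      show T.height (G'.compare G (T'.toFun (x, 0))) ∈ Ioo (-min c₁ Fr.δ) (min c₁ Fr.δ)
      rw [T'.toFun_zero, compare_jA, (T.height_eq_zero_iff _).2 (G.jA_incl_mem_seam x)]
      exact ⟨by linarith [lt_min hc₁ Fr.δ_pos], lt_min hc₁ Fr.δ_pos⟩)
  have hid₂ : ∀ q : bM.carrier × ℝ, |q.2| < min c₂ Fr.b → E.tinv q = q := by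
    intro q hq
    have hq₂ : |q.2| < c₂ := hq.trans_le (min_le_left _ _)
    have hqb : |q.2| < Fr.b := hq.trans_le (min_le_right _ _)
    have hr : |(gamHat T T' q).2| < min c₁ Fr.δ := by
      rw [gamHat_snd]
      exact abs_lt.2 (hsub₂ ⟨mem_univ q.1, (abs_lt.1 hq₂ : -c₂ < q.2 ∧ q.2 < c₂)⟩)
    rw [tinv, hid₁ _ hr]
    exact Fr.psiHat_gamHat (abs_lt.1 hqb)
  rintro q ⟨-, hq⟩
  refine ContMDiffAt.contMDiffWithinAt ?_
  rcases lt_trichotomy 0 q.2 with h | h | h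
  · -- above: `S₊⁻¹ ∘ Γ̂` on `∂M × (0, b)`
    have hO : IsOpen ((univ : Set bM.carrier) ×ˢ Ioo 0 Fr.b) := isOpen_univ.prod isOpen_Ioo
    have hqO : q ∈ (univ : Set bM.carrier) ×ˢ Ioo 0 Fr.b := ⟨mem_univ _, h, hq.2⟩
    have hmaps : MapsTo (gamHat T T') ((univ : Set bM.carrier) ×ˢ Ioo 0 Fr.b) (univ ×ˢ Ioi 0) :=
      fun q' hq' => ⟨mem_univ _, gamHat_snd_pos hq'.2⟩
    have hcomp : ContMDiffWithinAt ((𝓡 n).prod 𝓘(ℝ, ℝ)) ((𝓡 n).prod 𝓘(ℝ, ℝ)) ∞ (E.Spi ∘ gamHat T T')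
        (univ ×ˢ Ioo 0 Fr.b) q :=
      (E.smooth_Spi _ (hmaps hqO)).comp q
        ((Fr.contMDiffOn_gamHat_up q ⟨mem_univ _, h.le, hq.2⟩).mono
          (prod_mono Subset.rfl Ioo_subset_Ico_self)) hmaps
    refine (hcomp.contMDiffAt (hO.mem_nhds hqO)).congr_of_eventuallyEq ?_
    filter_upwards [hO.mem_nhds hqO] with q' hq'
    exact E.sfullInv_of_pos (gamHat_snd_pos hq'.2)
  · -- near the zero level: the identity
    have hq0 : |q.2| < min c₂ Fr.b := by rw [← h, abs_zero]; exact lt_min hc₂ Fr.b_pos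
    refine contMDiffAt_id.congr_of_eventuallyEq ?_
    filter_upwards [(isOpen_lt (continuous_abs.comp continuous_snd) continuous_const).mem_nhds hq0]
      with q' hq'
    exact hid₂ q' hq'
  · -- below: `refl ∘ S₋⁻¹ ∘ refl ∘ Γ̂` on `∂M × (-b, 0)`
    have hO : IsOpen ((univ : Set bM.carrier) ×ˢ Ioo (-Fr.b) 0) := isOpen_univ.prod isOpen_Ioo
    have hqO : q ∈ (univ : Set bM.carrier) ×ˢ Ioo (-Fr.b) 0 := ⟨mem_univ _, hq.1, h⟩
    have hmaps : MapsTo (reflT ∘ gamHat T T') ((univ : Set bM.carrier) ×ˢ Ioo (-Fr.b) 0) (univ ×ˢ Ioi 0) :=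
      fun q' hq' => ⟨mem_univ _, by
        show 0 < -(gamHat T T' q').2; linarith [gamHat_snd_neg' hq'.2]⟩
    have hin : ContMDiffWithinAt ((𝓡 n).prod 𝓘(ℝ, ℝ)) ((𝓡 n).prod 𝓘(ℝ, ℝ)) ∞ (reflT ∘ gamHat T T')
        (univ ×ˢ Ioo (-Fr.b) 0) q :=
      contMDiff_reflT.contMDiffAt.comp_contMDiffWithinAt q
        ((Fr.contMDiffOn_gamHat_down q ⟨mem_univ _, hq.1, h.le⟩).mono
          (prod_mono Subset.rfl Ioo_subset_Ioc_self))
    have hcomp : ContMDiffWithinAt ((𝓡 n).prod 𝓘(ℝ, ℝ)) ((𝓡 n).prod 𝓘(ℝ, ℝ)) ∞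
        (reflT ∘ (E.Smi ∘ (reflT ∘ gamHat T T'))) (univ ×ˢ Ioo (-Fr.b) 0) q :=
      contMDiff_reflT.contMDiffAt.comp_contMDiffWithinAt q
        ((E.smooth_Smi _ (hmaps hqO)).comp q hin hmaps)
    refine (hcomp.contMDiffAt (hO.mem_nhds hqO)).congr_of_eventuallyEq ?_
    filter_upwards [hO.mem_nhds hqO] with q' hq'
    exact E.sfullInv_of_neg (gamHat_snd_neg' hq'.2)

end Smooth

/-! ### The diffeomorphism `𝒢 : P ≅ P'` -/

/-- **The smoothing of the comparison map**: `T' ∘ 𝒯 ∘ T⁻¹` on the tube `{|f| < δ}`, `F`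
elsewhere. [folklore] -/
def glue (p : P) : P' :=
  if T.height p ∈ Ioo (-Fr.δ) Fr.δ then T'.toFun (E.tmap (T.invFun p)) else G.compare G' p

/-- **Its inverse**: `T ∘ 𝒯⁻¹ ∘ T'⁻¹` on the tube `{|f'| < b}`, `F⁻¹` elsewhere. [folklore] -/
def glueInv (p' : P') : P :=
  if T'.height p' ∈ Ioo (-Fr.b) Fr.b then T.toFun (E.tinv (T'.invFun p')) else G'.compare G p'

/-- **On the tube `{|f| < δ}` the smoothing is `F ∘ T ∘ S ∘ T⁻¹`.** [folklore] -/
theorem glue_of_mem {p : P} (hp : T.height p ∈ Ioo (-Fr.δ) Fr.δ) :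
    E.glue p = G.compare G' (T.toFun (E.sfull (T.invFun p))) := by
  rw [glue, if_pos hp, tmap, psiHat]
  have h1 : |(E.sfull (T.invFun p)).2| < Fr.δ := E.abs_sfull_snd_lt_δ (by rw [T.invFun_snd]; exact abs_lt.2 hp)
  have hb := Fr.slab_fwd (E.sfull (T.invFun p)) (abs_lt.1 h1)
  exact T'.toFun_invFun _ ⟨by linarith [hb.1, Fr.b_le], hb.2.trans_le Fr.b_le⟩

/-- **Off `{|f| < a₁}` the smoothing is the comparison map.** [folklore] -/
theorem glue_eq_compare {p : P} (hp : E.a₁ ≤ |T.height p|) : E.glue p = G.compare G' p := by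
  by_cases h : T.height p ∈ Ioo (-Fr.δ) Fr.δ
  · rw [E.glue_of_mem h, E.sfull_eq_self (by rwa [T.invFun_snd]),
      T.toFun_invFun p ⟨by linarith [h.1, Fr.δ_le], h.2.trans_le Fr.δ_le⟩]
  · rw [glue, if_neg h]

/-- **Off `{|f ∘ F⁻¹| < a₁}` the inverse smoothing is `F⁻¹`.** [folklore] -/
theorem glueInv_eq_compare {p' : P'} (hp : E.a₁ ≤ |T.height (G'.compare G p')|) :
    E.glueInv p' = G'.compare G p' := by
  by_cases h : T'.height p' ∈ Ioo (-Fr.b) Fr.b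
  · rw [glueInv, if_pos h]
    have h1 : T'.toFun (T'.invFun p') = p' := T'.toFun_invFun p' ⟨by linarith [h.1, Fr.b_le], h.2.trans_le Fr.b_le⟩
    have h2 : gamHat T T' (T'.invFun p') = T.invFun (G'.compare G p') := by rw [gamHat, h1]
    have h3 : E.a₁ ≤ |(gamHat T T' (T'.invFun p')).2| := by rwa [h2, T.invFun_snd]
    rw [E.tinv_eq_gamHat h3, h2]
    refine T.toFun_invFun _ (Fr.height_mem_of _ ?_)
    rwa [compare_compare]
  · rw [glueInv, if_neg h]

/-- **`𝒢⁻¹ ∘ 𝒢 = id`.** [folklore] -/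
theorem glueInv_glue (p : P) : E.glueInv (E.glue p) = p := by
  by_cases hp : T.height p ∈ Ioo (-Fr.δ) Fr.δ
  · set q := T.invFun p with hq
    have hq2 : q.2 = T.height p := T.invFun_snd p
    have hKq : T.toFun q = p := T.toFun_invFun p ⟨by linarith [hp.1, Fr.δ_le], hp.2.trans_le Fr.δ_le⟩
    set s := E.sfull q with hs
    have hs1 : |s.2| < Fr.δ := E.abs_sfull_snd_lt_δ (by rw [hq2]; exact abs_lt.2 hp)
    have hb := Fr.slab_fwd s (abs_lt.1 hs1)
    have hglue : E.glue p = G.compare G' (T.toFun s) := E.glue_of_mem hp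
    rw [hglue, glueInv, if_pos hb, tinv]
    have h1 : gamHat T T' (T'.invFun (G.compare G' (T.toFun s))) = s := by
      have := Fr.gamHat_psiHat (q := s) (abs_lt.1 hs1)
      rwa [psiHat] at this
    rw [h1, hs, E.sfullInv_sfull, hKq]
  · rw [glue, if_neg hp]
    refine (E.glueInv_eq_compare ?_).trans (G.compare_compare G' p)
    rw [compare_compare]
    refine E.a₁_lt.le.trans ?_
    rcases not_and_or.1 (show ¬ (-Fr.δ < T.height p ∧ T.height p < Fr.δ) from hp) with h | h
    · rw [not_lt] at h; rw [abs_of_nonpos (h.trans (by linarith [Fr.δ_pos]))]; linarith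
    · rw [not_lt] at h; exact h.trans (le_abs_self _)

/-- **`𝒢 ∘ 𝒢⁻¹ = id`.** [folklore] -/
theorem glue_glueInv (p' : P') : E.glue (E.glueInv p') = p' := by
  by_cases hp : T'.height p' ∈ Ioo (-Fr.b) Fr.b
  · set r := T'.invFun p' with hr
    have hr2 : r.2 = T'.height p' := T'.invFun_snd p'
    have hK'r : T'.toFun r = p' := T'.toFun_invFun p' ⟨by linarith [hp.1, Fr.b_le], hp.2.trans_le Fr.b_le⟩
    set q₀ := gamHat T T' r with hq₀
    have hq₀2 : q₀.2 = T.height (G'.compare G p') := by rw [hq₀, gamHat_snd, hK'r]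
    have hKq₀ : T.toFun q₀ = G'.compare G p' := by
      rw [hq₀, gamHat, hK'r]
      exact T.toFun_invFun _ (Fr.height_mem_of _ (by rwa [compare_compare]))
    rw [glueInv, if_pos hp, tinv]
    by_cases hsmall : |q₀.2| < Fr.δ
    · -- the modification zone
      have hq₁ : |(E.sfullInv q₀).2| < Fr.δ := E.abs_sfullInv_snd_lt E.a₁_lt.le hsmall
      have hmem : T.height (T.toFun (E.sfullInv q₀)) ∈ Ioo (-Fr.δ) Fr.δ := by
        rw [T.height_toFun _ _ ⟨by linarith [(abs_lt.1 hq₁).1, Fr.δ_le], (abs_lt.1 hq₁).2.trans_le Fr.δ_le⟩]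
        exact abs_lt.1 hq₁
      rw [E.glue_of_mem hmem, T.invFun_toFun _ _ ⟨by linarith [(abs_lt.1 hq₁).1, Fr.δ_le],
        (abs_lt.1 hq₁).2.trans_le Fr.δ_le⟩, Prod.mk.eta, E.sfull_sfullInv, hKq₀, compare_compare]
    · -- off the modification zone
      rw [not_lt] at hsmall
      have hid : E.sfullInv q₀ = q₀ := E.sfullInv_eq_self (E.a₁_lt.le.trans hsmall)
      rw [hid, hKq₀]
      have : ¬ T.height (G'.compare G p') ∈ Ioo (-Fr.δ) Fr.δ := by
        rw [← hq₀2]; intro h; exact absurd (abs_lt.2 h) (not_lt.2 hsmall)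
      rw [glue, if_neg this, compare_compare]
  · rw [glueInv, if_neg hp]
    have hlarge : ¬ T.height (G'.compare G p') ∈ Ioo (-Fr.δ) Fr.δ := fun h => hp (Fr.height_mem_of' p' h)
    rw [glue, if_neg hlarge, compare_compare]

/-- **The smoothing as an equivalence.** [folklore] -/
def glueEquiv : P ≃ P' where
  toFun := E.glue
  invFun := E.glueInv
  left_inv := E.glueInv_glue
  right_inv := E.glue_glueInv

section SmoothGlue

variable [T2Space M] [T2Space N] [CompactSpace M] [CompactSpace N]
  [IsManifold (𝓡∂ (n + 1)) ∞ M] [IsManifold (𝓡∂ (n + 1)) ∞ N] [IsManifold (𝓡 (n + 1)) ∞ P]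
  [IsManifold (𝓡 (n + 1)) ∞ P'] [Nonempty bM.carrier]

omit [T2Space M] [T2Space N] [CompactSpace M] [CompactSpace N] in
/-- **The smoothing is `C^∞`.** On the open tube `{|f| < δ}` it is `T' ∘ 𝒯 ∘ T⁻¹`; on the open
set `{|f| > a₁}` it is the comparison map, smooth off the seam. [folklore] -/
theorem contMDiff_glue : ContMDiff (𝓡 (n + 1)) (𝓡 (n + 1)) ∞ E.glue := by
  intro p
  by_cases hp : T.height p ∈ Ioo (-Fr.δ) Fr.δ
  · have hO : IsOpen (T.height ⁻¹' Ioo (-Fr.δ) Fr.δ) := isOpen_Ioo.preimage T.contMDiff_height.continuous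
    have h1 : ContMDiffAt (𝓡 (n + 1)) ((𝓡 n).prod 𝓘(ℝ, ℝ)) ∞ T.invFun p :=
      T.contMDiffAt_invFun ⟨by linarith [hp.1, Fr.δ_le], hp.2.trans_le Fr.δ_le⟩
    have h2 : ContMDiffAt ((𝓡 n).prod 𝓘(ℝ, ℝ)) ((𝓡 n).prod 𝓘(ℝ, ℝ)) ∞ E.tmap (T.invFun p) :=
      E.contMDiffOn_tmap.contMDiffAt ((isOpen_univ.prod isOpen_Ioo).mem_nhds
        ⟨mem_univ _, by rw [T.invFun_snd]; exact hp⟩)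
    have h3 := (T'.contMDiff_toFun _).comp p (h2.comp p h1)
    refine h3.congr_of_eventuallyEq ?_
    filter_upwards [hO.mem_nhds hp] with p' hp'
    exact if_pos hp'
  · have hge : Fr.δ ≤ |T.height p| := by
      rcases not_and_or.1 (show ¬ (-Fr.δ < T.height p ∧ T.height p < Fr.δ) from hp) with h | h
      · rw [not_lt] at h; rw [abs_of_nonpos (h.trans (by linarith [Fr.δ_pos]))]; linarith
      · rw [not_lt] at h; exact h.trans (le_abs_self _)
    have hO : IsOpen {p' : P | E.a₁ < |T.height p'|} :=
      isOpen_lt continuous_const (continuous_abs.comp T.contMDiff_height.continuous)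
    have hpO : E.a₁ < |T.height p| := E.a₁_lt.trans_le hge
    have hns : p ∉ G.seam := fun hs => by
      rw [(T.height_eq_zero_iff p).2 hs, abs_zero] at hpO
      exact absurd hpO (not_lt.2 E.a₁_pos.le)
    refine (G.contMDiffAt_compare G' hns).congr_of_eventuallyEq ?_
    filter_upwards [hO.mem_nhds hpO] with p' hp'
    exact E.glue_eq_compare hp'.le

omit [T2Space M] [T2Space N] [CompactSpace N] in
/-- **The inverse smoothing is `C^∞`.** [folklore] -/
theorem contMDiff_glueInv : ContMDiff (𝓡 (n + 1)) (𝓡 (n + 1)) ∞ E.glueInv := by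
  intro p'
  by_cases hp : T'.height p' ∈ Ioo (-Fr.b) Fr.b
  · have hO : IsOpen (T'.height ⁻¹' Ioo (-Fr.b) Fr.b) := isOpen_Ioo.preimage T'.contMDiff_height.continuous
    have h1 : ContMDiffAt (𝓡 (n + 1)) ((𝓡 n).prod 𝓘(ℝ, ℝ)) ∞ T'.invFun p' :=
      T'.contMDiffAt_invFun ⟨by linarith [hp.1, Fr.b_le], hp.2.trans_le Fr.b_le⟩
    have h2 : ContMDiffAt ((𝓡 n).prod 𝓘(ℝ, ℝ)) ((𝓡 n).prod 𝓘(ℝ, ℝ)) ∞ E.tinv (T'.invFun p') :=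
      E.contMDiffOn_tinv.contMDiffAt ((isOpen_univ.prod isOpen_Ioo).mem_nhds
        ⟨mem_univ _, by rw [T'.invFun_snd]; exact hp⟩)
    have h3 := (T.contMDiff_toFun _).comp p' (h2.comp p' h1)
    refine h3.congr_of_eventuallyEq ?_
    filter_upwards [hO.mem_nhds hp] with q hq
    exact if_pos hq
  · -- off the tube: `|f (F⁻¹ p')| ≥ δ > a₁`, and `glueInv = F⁻¹` on the open set `{|f ∘ F⁻¹| > a₁}`
    have hge : Fr.δ ≤ |T.height (G'.compare G p')| := by
      by_contra h
      rw [not_le] at h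
      exact hp (Fr.height_mem_of' p' (abs_lt.1 h))
    have hO : IsOpen {q : P' | E.a₁ < |T.height (G'.compare G q)|} :=
      isOpen_lt continuous_const (continuous_abs.comp (T.contMDiff_height.continuous.comp
        (G'.continuous_compare G)))
    have hpO : E.a₁ < |T.height (G'.compare G p')| := E.a₁_lt.trans_le hge
    have hns : p' ∉ G'.seam := fun hs => by
      have : G'.compare G p' ∈ G.seam := by rwa [G'.compare_mem_seam_iff G]
      rw [(T.height_eq_zero_iff _).2 this, abs_zero] at hpO
      exact absurd hpO (not_lt.2 E.a₁_pos.le)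
    refine (G'.contMDiffAt_compare G hns).congr_of_eventuallyEq ?_
    filter_upwards [hO.mem_nhds hpO] with q hq
    exact E.glueInv_eq_compare hq.le

/-- **The smoothing as a diffeomorphism `P ≅ P'`** (Hirsch's `f' ∪ f''`). [folklore] -/
def glueDiffeomorph : P ≃ₘ⟮𝓡 (n + 1), 𝓡 (n + 1)⟯ P' where
  toEquiv := E.glueEquiv
  contMDiff_toFun := E.contMDiff_glue
  contMDiff_invFun := E.contMDiff_glueInv

end SmoothGlue

end Ext

end ComparisonFrame

/-! ### Uniqueness of gluings -/

section Main

variable [T2Space M] [T2Space N] [CompactSpace M] [CompactSpace N]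
  [IsManifold (𝓡∂ (n + 1)) ∞ M] [IsManifold (𝓡∂ (n + 1)) ∞ N] [IsManifold (𝓡 (n + 1)) ∞ P]
  [IsManifold (𝓡 (n + 1)) ∞ P']

omit [T2Space M] [T2Space N] [CompactSpace M] [CompactSpace N] in
/-- **Empty boundary**: if `∂M = ∅` the comparison map itself is a diffeomorphism (the seam is
empty and the comparison map is smooth off the seam). [folklore] -/
def compareDiffeomorphOfIsEmpty (G : BoundaryGluingData bM bN φ P) (G' : BoundaryGluingData bM bN φ P')
    [IsEmpty bM.carrier] : P ≃ₘ⟮𝓡 (n + 1), 𝓡 (n + 1)⟯ P' where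
  toEquiv := G.compareEquiv G'
  contMDiff_toFun p := G.contMDiffAt_compare G' (by rintro ⟨z, -⟩; exact IsEmpty.false z)
  contMDiff_invFun p := G'.contMDiffAt_compare G (by rintro ⟨z, -⟩; exact IsEmpty.false z)

/-- **Uniqueness of gluings (Hirsch, *Differential Topology*, Ch. 8, Thm. 2.1 with Thm. 1.9;
Bröcker–Jänich (1982), (13.9) with (13.7)).** Two smooth manifolds `P`, `P'` which are both the
gluing `M ∪_φ N` of the same compact Hausdorff pieces along the same identification of the
boundaries — i.e. which both carry gluing data over `(bM, bN, φ)` — are diffeomorphic.  The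
diffeomorphism is the comparison map `jA a ↦ jA' a`, `jB b ↦ jB' b` corrected near the seam by
the uniqueness of collars (`ComparisonFrame.Ext.glueDiffeomorph`).
[cite: HirschDT1976, Ch. 8 §2, Thm. 2.1] -/
theorem nonempty_diffeomorph (G : BoundaryGluingData bM bN φ P) (G' : BoundaryGluingData bM bN φ P') :
    Nonempty (P ≃ₘ⟮𝓡 (n + 1), 𝓡 (n + 1)⟯ P') := by
  rcases isEmpty_or_nonempty bM.carrier with hE | hE
  · exact ⟨compareDiffeomorphOfIsEmpty G G'⟩
  · set T := G.seamTube
    set T' := G'.seamTube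
    obtain ⟨Fr⟩ := exists_comparisonFrame T T'
    obtain ⟨E⟩ := Fr.nonempty_ext
    exact ⟨E.glueDiffeomorph⟩

end Main

end BoundaryGluingData

end Literature.Topology.FourManifolds
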